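import Literature.MathematicalPhysics.QuantumFieldTheory.Balaban1983to89.B6Cover236MultiLevelBlocks
import Literature.MathematicalPhysics.QuantumFieldTheory.Balaban1983to89.B4PartitionUnity22

/-!
# `Balaban1983to89.B6Partition118KLevelFine` — T. Bałaban, *Propagators and renormalization transformations for lattice gauge theories. II*,
# Commun. Math. Phys. **96** (1984) 223–250 [Balaban1984PropagatorsII], p. 229 (2.36) with [Balaban1984PropagatorsI] (1.118) p. 36: THE SMOOTH
# PARTITION OF UNITY `{h_□}_{□∈𝒟}`, `Σ_□ h_□² = 1`, OF THE GENUINE MULTI-LEVEL COVER — ON THE FINE LATTICE (file 1: the `C^∞` bumps of the cubes of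
# p21's cover `cubes D`, the normalised family `h_□ = θ_□/(Σθ²)^{1/2}` AT FINE SITES, `Σ_□ h_□(x)² = 1`, `0 ≤ h_□ ≤ 1`, `supp h_□ ⊂ □`, the levels and
# blocks met by `□`, and the finite-difference sizes of the bumps `|∂θ_□| ≤ D₁/S`, `|∂²θ_□| ≤ D₂/S²` uniformly in the lattice)

statement-level skeleton of published theorems with citation tags; proofs where landed; nothing here is a claim about the Yang–Mills mass gap

PDF held: `paper:balaban1984-cmp96-propagators-rt-ii` (journal page = PDF page + 222): p. 229 [PDF 7] (before (2.36)), p. 239 [PDF 17] ((2.89)–(2.92)),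
p. 247 [PDF 25] ((2.134)); [Balaban1984PropagatorsI] (1.118) p. 36 (`paper:balaban1984-cmp95-propagators-rt-i`, journal page = PDF page + 16) — read from
the tree transcriptions in `…B6Cover236MultiLevelBlocks` (p21, p. 229/235/237 re-read there) and `…B4PartitionUnity22` (r01, (1.118) quoted there).
PRINT p. 229: *"We construct also the corresponding family of functions h described in (1.118), and rescale them to proper scales. They satisfy
Σ_{□∈𝒟} h_□² = 1. (2.36)"*; (1.118) p. 36: *"h ∈ C₀^∞(]−⅔, ⅔[), h(t) = 1 for t ∈ [−⅓, ⅓], h is chosen in such a way that Σ_n h²(t − n) = 1"*;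
p. 239 before (2.89): *"Let us take the partition of unity {h_□²}_{□∈𝒟} and the corresponding family of functions ζ_□ ∈ C₀^∞(□̃) …"*;
p. 247 after (2.134): the commutator `[h_□, ·]` costs `O(M⁻¹)` (the uses of `|∂h_□| ≤ O(1)(ML^jη)^{−1}`, `|Δh_□| ≤ O(1)(ML^jη)^{−2}`).

CITATION HEADER (lean-in-tree rule) — WHAT IS REPRODUCED.  Phase-2 file of the `lit-balaban` typed skeleton (HOME `run/shared/lean/pub/lit-balaban/`), seat
**p38 gen 25**; the owner-named task (1) of B6-CLOSURE §5 item 7 (r03 g18, 2026-08-22T22:35:35Z: *"YES, take (1) `B6Partition118KLevelFine` (smooth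
`hprof` profile, p21's cubes/Q/js/window/gap/overlap by name, θ/√(Σθ²) …)"*); SKELETON rows **B6.Eq2.36** × **B5.Eq1.118** × **B6.Eq2.91/2.134**
(cells only; decls of record untouched; referee ref-4).  p21's `…B6Cover236MultiLevelBlocks` constructed (2.36) ON THE BLOCK LATTICE `𝔅` with a
piecewise-linear profile (`psi`, `theta`, `hcov`) — enough for Prop. 2.3's (2.82)–(2.85), where only values at block centres and ONE Lipschitz bound
enter.  Prop. 2.6's (2.92)/(2.134) act on the FINE lattice and differentiate `h_□` TWICE (line 1 of (2.92): `∂h_□`, `Δh_□` with the sizes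
`(ML^jη)^{−1}`, `(M(L^jη)²)^{−1}·O(1)` — a piecewise-linear profile has second differences `~(ML^jη·η)^{−1}` at its kinks, too big for `j ≥ 1`), so
THIS FILE rebuilds the family with r01's `C^∞` profile `…B4PartitionUnity22.hprof` (the printed (1.118) object) on the SAME cover:
* §1 `thetaF D □ p = Π_μ hprof((p_μ − ctr_μ)/(8S/5))` (`S = side D □ = ML^j` fine sites, `ctr` p21's centre): `0 ≤ θ ≤ 1`, `= 1` within `3S/5 ⊇ S/2`
  of the centre (the big block), `≠ 0` only within `S` (the cube □ — the SAME support as p21's `theta`), `(d+1)D₁/(8S/5)`-Lipschitz in the sup metric,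
  and along every axis `|θ(p + ηe_μ) − θ(p)| ≤ D₁|η|/(8S/5)`, `|θ(p + ηe_μ) − 2θ(p) + θ(p − ηe_μ)| ≤ D₂η²/(8S/5)²` (`D₁ = sup|h′|`, `D₂ = sup|h″|`, r01's
  `abs_prod_diff_le` / `abs_prod_second_diff_le` BY NAME through `thetaF_eq_hCube`);
* §2 the own big block at FINE sites: `blk_{ML^j}(x) = ` the label of `own (blkOf x)` (big blocks are unions of blocks), so `θ_{own}(x) = 1`;
* §3 **(2.36) AT FINE SITES**: `nsqF x = Σ_□ θ_□(x)² ≥ 1`, `hF □ x = θ_□(x)/nsqF(x)^{1/2}`, **`Σ_□ hF □ x² = 1`**, `0 ≤ hF ≤ 1`, `hF □ x ≠ 0 ⇒ |x − ctr|_∞ < S`;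
* §4 the support meets only the two-level window: `|x − ctr_□|_∞ < S ⇒ lev x ∈ {j−1, j, j+1}` (p21's `Domains.lev_window` at the cube's witness) and,
  for `M_h ≥ 2`, `blkOf x ∈ Q D □` (p21's enlarged cube `□⁺`, where `hcube`/`window`/`gap_of_cubeInd_eq_zero` apply BY NAME).
No new fact; four `def`s with bodies (`sF`, `thetaF`, `nsqF`, `hF`); standard axioms.
HONEST SCOPE / DIVERGENCES. (1) Print fixes the profile only up to (1.118)/(2.36) and the gradient sizes; the normalisation `θ/(Σθ²)^{1/2}` ACROSS
ADJACENT LEVELS is ours (as in p21's block version, cell divergence D-b06.38/42) — print does not say how the level-`j` and level-`(j+1)` families are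
matched on `∂B^{j+1}(Λ_{j+1})`. (2) File 1 of two: the overlap count at fine sites, the comparability of the scales of the cubes active at one site, and
from them the binder shapes of `…B6Ineq2134KFamKLevel.h2134_kFam_kLevel` (`|h_□(x′) − h_□(x)| ≤ (s/M)(d + r₀)`, line-1 sizes `s₁/(M·L^jη)`,
`s₂/(M·(L^jη)²)`, the sets `S_□ ⊆ T_□`, `Score_□`, the gap `m·M`, `ζ_□ :=` an indicator) are file 2. (3) Integer box of p21's `Domains` (`L = ℓ+1`,
`M = L·M_h`, levels `1…k`); nothing on d = 4 or the continuum; NOT summit progress.  Unit `lit-balaban-p38` (gen 25), 2026-08-22.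
-/

namespace Literature.MathematicalPhysics.QuantumFieldTheory.Balaban1983to89.B6Partition118KLevelFine

open Finset
open Literature.MathematicalPhysics.QuantumFieldTheory.Balaban1983to89.B4ContourShift (supNorm)
open Literature.MathematicalPhysics.QuantumFieldTheory.Balaban1983to89.B4Reflection242 (boxDom mem_boxDom blk)
open Literature.MathematicalPhysics.QuantumFieldTheory.Balaban1983to89.B6MultiLevelBoxOperator
open Literature.MathematicalPhysics.QuantumFieldTheory.Balaban1983to89.B6Geom246MultiLevelBox
open Literature.MathematicalPhysics.QuantumFieldTheory.Balaban1983to89.B6Cover236MultiLevelBlocks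
  (cubes wit lev_wit blk_wit side side_eq side_pos ctr dist_toR_ctr_le own Q mem_Q)
open Literature.MathematicalPhysics.QuantumFieldTheory.Balaban1983to89.B4PartitionUnity22
  (hprof hprof_nonneg hprof_le_one hprof_eq_one hprof_eq_zero contDiff_hprof hasCompactSupport_hprof D1 D2 D1_nonneg D2_nonneg hCube
    abs_sub_le_D1 abs_prod_diff_le abs_prod_second_diff_le)

variable {d : ℕ} {ℓ Mh k R : ℕ} {P : Fin (d + 1) → ℕ} (D : Domains d ℓ Mh k P R)

/-! ## §1  The smooth bump of a cube of the cover, at points of `ℝ^{d+1}` -/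

/-- the scale `8S/5` of the profile: with r01's `hprof` (`= 1` on `|t| ≤ 3/8`, `= 0` on `|t| ≥ 5/8`) the bump is `1` within `3S/5` of the centre and
vanishes outside `S`. OURS. [cite: Balaban1984PropagatorsII, p.229 («rescale them to proper scales»)] -/
noncomputable def sF (i : ↥(cubes D)) : ℝ := 8 / 5 * side D i

/-- `8S/5 > 0`. [cite: Balaban1984PropagatorsII, p.229, bookkeeping] -/
theorem sF_pos (hMh : 1 ≤ Mh) (i : ↥(cubes D)) : 0 < sF D i := by
  unfold sF; exact mul_pos (by norm_num) (side_pos D hMh i)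

/-- **THE SMOOTH BUMP `θ_□`** of the cube of an active big block: `Π_μ h((p_μ − ctr_μ)/(8S/5))` with the (1.118) profile `h = hprof`.
[cite: Balaban1984PropagatorsII, p.229 («the corresponding family of functions h described in (1.118)»); Balaban1984PropagatorsI, (1.118) p.36] -/
noncomputable def thetaF (i : ↥(cubes D)) (p : Fin (d + 1) → ℝ) : ℝ := ∏ μ, hprof ((p μ - ctr D i μ) / sF D i)

/-- the bump is r01's `hCube` at scale `8S/5`, label `0`, recentred. [cite: Balaban1984PropagatorsI, (1.118) p.36, dictionary] -/
theorem thetaF_eq_hCube (i : ↥(cubes D)) (p : Fin (d + 1) → ℝ) :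
    thetaF D i p = hCube (sF D i) (0 : Fin (d + 1) → ℤ) (fun μ => p μ - ctr D i μ) := by
  unfold thetaF hCube
  simp

/-- `θ ≥ 0`. [cite: Balaban1984PropagatorsII, p.229 before (2.36), bookkeeping] -/
theorem thetaF_nonneg (i : ↥(cubes D)) (p : Fin (d + 1) → ℝ) : 0 ≤ thetaF D i p :=
  Finset.prod_nonneg fun _ _ => hprof_nonneg _

/-- `θ ≤ 1`. [cite: Balaban1984PropagatorsII, p.229 before (2.36), bookkeeping] -/
theorem thetaF_le_one (i : ↥(cubes D)) (p : Fin (d + 1) → ℝ) : thetaF D i p ≤ 1 :=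
  Finset.prod_le_one (fun _ _ => hprof_nonneg _) fun _ _ => hprof_le_one _

/-- `θ_□ = 1` within `3S/5` of the centre (in particular on the big block, radius `S/2`). [cite: Balaban1984PropagatorsI, (1.118) p.36 («h(t) = 1 for t ∈ [−⅓, ⅓]»)] -/
theorem thetaF_eq_one (hMh : 1 ≤ Mh) {i : ↥(cubes D)} {p : Fin (d + 1) → ℝ} (h : dist p (ctr D i) ≤ 3 / 5 * side D i) :
    thetaF D i p = 1 := by
  have hS := side_pos D hMh i
  have hs := sF_pos D hMh i
  refine Finset.prod_eq_one fun μ _ => hprof_eq_one ?_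
  rw [abs_div, abs_of_pos hs, div_le_iff₀ hs]
  have := dist_le_pi_dist p (ctr D i) μ
  rw [Real.dist_eq] at this
  unfold sF; linarith

/-- `θ_□ = 1` on the big block. [cite: Balaban1984PropagatorsII, p.229, bookkeeping] -/
theorem thetaF_eq_one_half (hMh : 1 ≤ Mh) {i : ↥(cubes D)} {p : Fin (d + 1) → ℝ} (h : dist p (ctr D i) ≤ side D i / 2) :
    thetaF D i p = 1 :=
  thetaF_eq_one D hMh (h.trans (by have := side_pos D hMh i; linarith))

/-- `θ_□ ≠ 0` only within `S` of the centre (the cube □ of side `2S` — the same support as p21's `theta`).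
[cite: Balaban1984PropagatorsII, p.229 («cubes □ of the size 2ML^jη»), bookkeeping] -/
theorem dist_lt_of_thetaF_ne_zero (hMh : 1 ≤ Mh) {i : ↥(cubes D)} {p : Fin (d + 1) → ℝ} (h : thetaF D i p ≠ 0) :
    dist p (ctr D i) < side D i := by
  have hS := side_pos D hMh i
  have hs := sF_pos D hMh i
  by_contra hge
  have hex : ¬ ∀ μ, dist (p μ) (ctr D i μ) < side D i := fun hall => hge ((dist_pi_lt_iff hS).2 hall)
  push Not at hex
  obtain ⟨μ, hμ⟩ := hex
  apply h
  refine Finset.prod_eq_zero (Finset.mem_univ μ) (hprof_eq_zero ?_)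
  rw [abs_div, abs_of_pos hs, le_div_iff₀ hs]
  rw [Real.dist_eq] at hμ
  unfold sF; linarith

/-- products of `[0, 1]`-valued factors: `|Πa − Πb| ≤ Σ|a − b|`. [folklore] -/
private theorem abs_prod_sub_prod_le_sum {ι : Type*} (s : Finset ι) {a b : ι → ℝ}
    (ha0 : ∀ i ∈ s, 0 ≤ a i) (ha1 : ∀ i ∈ s, a i ≤ 1) (hb0 : ∀ i ∈ s, 0 ≤ b i) (hb1 : ∀ i ∈ s, b i ≤ 1) :
    |∏ i ∈ s, a i - ∏ i ∈ s, b i| ≤ ∑ i ∈ s, |a i - b i| := by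
  classical
  induction s using Finset.induction_on with
  | empty => simp
  | insert j s hj ih =>
    have ha0' : ∀ i ∈ s, 0 ≤ a i := fun i hi => ha0 i (Finset.mem_insert_of_mem hi)
    have ha1' : ∀ i ∈ s, a i ≤ 1 := fun i hi => ha1 i (Finset.mem_insert_of_mem hi)
    have hb0' : ∀ i ∈ s, 0 ≤ b i := fun i hi => hb0 i (Finset.mem_insert_of_mem hi)
    have hb1' : ∀ i ∈ s, b i ≤ 1 := fun i hi => hb1 i (Finset.mem_insert_of_mem hi)
    have ih' := ih ha0' ha1' hb0' hb1'
    have haj0 := ha0 j (Finset.mem_insert_self _ _)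
    have haj1 := ha1 j (Finset.mem_insert_self _ _)
    have hB0 : 0 ≤ ∏ i ∈ s, b i := Finset.prod_nonneg hb0'
    have hB1 : ∏ i ∈ s, b i ≤ 1 := Finset.prod_le_one hb0' hb1'
    rw [Finset.prod_insert hj, Finset.prod_insert hj, Finset.sum_insert hj]
    have e : a j * ∏ i ∈ s, a i - b j * ∏ i ∈ s, b i =
        a j * (∏ i ∈ s, a i - ∏ i ∈ s, b i) + (a j - b j) * ∏ i ∈ s, b i := by ring
    rw [e]
    calc |a j * (∏ i ∈ s, a i - ∏ i ∈ s, b i) + (a j - b j) * ∏ i ∈ s, b i|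
        ≤ |a j * (∏ i ∈ s, a i - ∏ i ∈ s, b i)| + |(a j - b j) * ∏ i ∈ s, b i| := abs_add_le _ _
      _ = a j * |∏ i ∈ s, a i - ∏ i ∈ s, b i| + |a j - b j| * ∏ i ∈ s, b i := by
          rw [abs_mul, abs_mul, abs_of_nonneg haj0, abs_of_nonneg hB0]
      _ ≤ 1 * |∏ i ∈ s, a i - ∏ i ∈ s, b i| + |a j - b j| * 1 := by
          have := abs_nonneg (∏ i ∈ s, a i - ∏ i ∈ s, b i)
          have := abs_nonneg (a j - b j)
          nlinarith
      _ ≤ |a j - b j| + ∑ i ∈ s, |a i - b i| := by linarith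

/-- **THE BUMP IS `(d+1)D₁/(8S/5)`-LIPSCHITZ** in the sup metric of `ℝ^{d+1}` («|∂h_□| ≤ O(1)(ML^jη)^{−1}»).
[cite: Balaban1984PropagatorsII, p.247 after (2.134); Balaban1983RegularityDecay, §2 p.577 («|∂^ηh_j| ≤ O(M⁻¹)»)] -/
theorem abs_thetaF_sub_le (hMh : 1 ≤ Mh) (i : ↥(cubes D)) (p p' : Fin (d + 1) → ℝ) :
    |thetaF D i p - thetaF D i p'| ≤ ((d : ℝ) + 1) * D1 hprof / sF D i * dist p p' := by
  have hs := sF_pos D hMh i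
  have hD1 := D1_nonneg contDiff_hprof hasCompactSupport_hprof
  unfold thetaF
  calc |∏ μ, hprof ((p μ - ctr D i μ) / sF D i) - ∏ μ, hprof ((p' μ - ctr D i μ) / sF D i)|
      ≤ ∑ μ, |hprof ((p μ - ctr D i μ) / sF D i) - hprof ((p' μ - ctr D i μ) / sF D i)| :=
        abs_prod_sub_prod_le_sum _ (fun _ _ => hprof_nonneg _) (fun _ _ => hprof_le_one _)
          (fun _ _ => hprof_nonneg _) fun _ _ => hprof_le_one _
    _ ≤ ∑ _μ : Fin (d + 1), D1 hprof * (dist p p' / sF D i) := by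
        refine Finset.sum_le_sum fun μ _ => ?_
        have h1 := abs_sub_le_D1 contDiff_hprof hasCompactSupport_hprof ((p' μ - ctr D i μ) / sF D i) ((p μ - ctr D i μ) / sF D i)
        refine h1.trans (mul_le_mul_of_nonneg_left ?_ hD1)
        rw [← sub_div, abs_div, abs_of_pos hs, show p μ - ctr D i μ - (p' μ - ctr D i μ) = p μ - p' μ by ring]
        have := dist_le_pi_dist p p' μ
        rw [Real.dist_eq] at this
        exact div_le_div_of_nonneg_right this hs.le
    _ = ((d : ℝ) + 1) * D1 hprof / sF D i * dist p p' := by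
        rw [Finset.sum_const, Finset.card_univ, Fintype.card_fin, nsmul_eq_mul]; push_cast; ring

/-- recentring commutes with a move along an axis. [folklore] -/
private theorem update_sub_ctr (i : ↥(cubes D)) (p : Fin (d + 1) → ℝ) (μ : Fin (d + 1)) (v : ℝ) :
    (fun ν => Function.update p μ v ν - ctr D i ν) =
      Function.update (fun ν => p ν - ctr D i ν) μ (v - ctr D i μ) := by
  funext ν
  by_cases h : ν = μ
  · subst h; simp
  · simp [Function.update_of_ne h]

/-- **«|∂^ηθ_□| ≤ O(1)(ML^jη)^{−1}» ALONG AN AXIS, UNIFORMLY IN THE STEP**: `|θ_□(p + ηe_μ) − θ_□(p)| ≤ D₁·|η|/(8S/5)` (r01's `abs_prod_diff_le`).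
[cite: Balaban1984PropagatorsII, p.247 after (2.134); Balaban1983RegularityDecay, §2 p.577] -/
theorem abs_thetaF_axis_diff_le (hMh : 1 ≤ Mh) (i : ↥(cubes D)) (p : Fin (d + 1) → ℝ) (μ : Fin (d + 1)) (η : ℝ) :
    |thetaF D i (Function.update p μ (p μ + η)) - thetaF D i p| ≤ D1 hprof * |η| / sF D i := by
  rw [thetaF_eq_hCube, thetaF_eq_hCube, update_sub_ctr]
  have e : p μ + η - ctr D i μ = (fun ν => p ν - ctr D i ν) μ + η := by simp only; ring
  rw [e]
  exact abs_prod_diff_le contDiff_hprof hasCompactSupport_hprof hprof_nonneg hprof_le_one (sF_pos D hMh i) 0 _ μ η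

/-- **«|Δ^ηθ_□| ≤ O(1)(ML^jη)^{−2}» ALONG AN AXIS, UNIFORMLY IN THE STEP**: `|θ_□(p + ηe_μ) − 2θ_□(p) + θ_□(p − ηe_μ)| ≤ D₂·η²/(8S/5)²`
(r01's `abs_prod_second_diff_le`). [cite: Balaban1984PropagatorsII, p.247 after (2.134); Balaban1983RegularityDecay, §2 p.577] -/
theorem abs_thetaF_axis_second_diff_le (i : ↥(cubes D)) (p : Fin (d + 1) → ℝ) (μ : Fin (d + 1)) (η : ℝ) :
    |thetaF D i (Function.update p μ (p μ + η)) - 2 * thetaF D i p + thetaF D i (Function.update p μ (p μ - η))|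
      ≤ D2 hprof * η ^ 2 / sF D i ^ 2 := by
  rw [thetaF_eq_hCube, thetaF_eq_hCube, thetaF_eq_hCube, update_sub_ctr, update_sub_ctr]
  have e1 : p μ + η - ctr D i μ = (fun ν => p ν - ctr D i ν) μ + η := by simp only; ring
  have e2 : p μ - η - ctr D i μ = (fun ν => p ν - ctr D i ν) μ - η := by simp only; ring
  rw [e1, e2]
  exact abs_prod_second_diff_le contDiff_hprof hasCompactSupport_hprof hprof_nonneg hprof_le_one (sF D i) 0 _ μ η

/-! ## §2  The own big block at fine sites -/

/-- big blocks are unions of blocks: the `ML^j`-label of a site of the `j`-block `(j, y)` is that of the block's corner, i.e. the label of p21's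
`own (blkOf x)`. [cite: Balaban1984PropagatorsII, (2.1) p.224 («Ω_j^{(j)} … is a sum of big blocks»), bookkeeping] -/
theorem blk_bigSide_eq_own (x : ↥(boxDom (N0 ℓ Mh k P))) :
    blk (bigSide ℓ Mh (D.lev x.1)) x.1 = (own D (blkOf D x)).1.2 := by
  show blk (bigSide ℓ Mh (D.lev x.1)) x.1 = blk (bigSide ℓ Mh (blkOf D x).1.1) (corner D (blkOf D x))
  have hlev : (blkOf D x).1.1 = D.lev x.1 := rfl
  rw [hlev]
  funext μ
  set n : ℕ := (ℓ + 1) ^ D.lev x.1 with hn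
  have hn0 : (0 : ℤ) ≤ (n : ℤ) := by positivity
  have hS : (bigSide ℓ Mh (D.lev x.1) : ℤ) = (n : ℤ) * ((Mh * (ℓ + 1) : ℕ) : ℤ) := by
    rw [bigSide_eq]; push_cast; rw [hn]; push_cast; ring
  have hc : corner D (blkOf D x) μ = (n : ℤ) * (blkOf D x).1.2 μ := rfl
  have hlab : (blkOf D x).1.2 μ = x.1 μ / (n : ℤ) := rfl
  show x.1 μ / (bigSide ℓ Mh (D.lev x.1) : ℤ) = corner D (blkOf D x) μ / (bigSide ℓ Mh (D.lev x.1) : ℤ)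
  rw [hS, hc, hlab, ← Int.ediv_ediv_of_nonneg hn0, ← Int.ediv_ediv_of_nonneg hn0]
  congr 1
  by_cases hn' : (n : ℤ) = 0
  · simp [hn']
  · rw [Int.mul_ediv_cancel_left _ hn']

/-- **the bump of the own big block is `1` at every site of the block** (the site lies in the big block, within `S/2` of its centre).
[cite: Balaban1984PropagatorsII, p.229 («Each set Λ_j is a sum of big blocks»), bookkeeping] -/
theorem thetaF_own_eq_one (hMh : 1 ≤ Mh) (x : ↥(boxDom (N0 ℓ Mh k P))) :
    thetaF D (own D (blkOf D x)) (toR x.1) = 1 := by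
  refine thetaF_eq_one_half D hMh (dist_toR_ctr_le D hMh ?_)
  have hlev : (own D (blkOf D x)).1.1 = D.lev x.1 := rfl
  rw [hlev]
  exact blk_bigSide_eq_own D x

/-! ## §3  (2.36) at fine sites: `h_□ = θ_□/(Σ_{□′}θ_{□′}²)^{1/2}`, `Σ_□ h_□² = 1` -/

/-- the normalising sum `Σ_□ θ_□(x)²` at a fine site. [cite: Balaban1984PropagatorsII, (2.36) p.229, bookkeeping] -/
noncomputable def nsqF (x : ↥(boxDom (N0 ℓ Mh k P))) : ℝ := ∑ i : ↥(cubes D), thetaF D i (toR x.1) ^ 2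

/-- `Σ_□ θ_□(x)² ≥ 1` (the own big block contributes `1`). [cite: Balaban1984PropagatorsII, (2.36) p.229, bookkeeping] -/
theorem one_le_nsqF (hMh : 1 ≤ Mh) (x : ↥(boxDom (N0 ℓ Mh k P))) : 1 ≤ nsqF D x := by
  unfold nsqF
  calc (1 : ℝ) = thetaF D (own D (blkOf D x)) (toR x.1) ^ 2 := by rw [thetaF_own_eq_one D hMh x]; norm_num
    _ ≤ ∑ i, thetaF D i (toR x.1) ^ 2 :=
        Finset.single_le_sum (f := fun i => thetaF D i (toR x.1) ^ 2) (fun i _ => sq_nonneg _) (Finset.mem_univ _)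

/-- `Σ_□ θ_□(x)² > 0`. [cite: Balaban1984PropagatorsII, (2.36) p.229, bookkeeping] -/
theorem nsqF_pos (hMh : 1 ≤ Mh) (x : ↥(boxDom (N0 ℓ Mh k P))) : 0 < nsqF D x :=
  lt_of_lt_of_le one_pos (one_le_nsqF D hMh x)

/-- **`h_□` AT FINE SITES**: `θ_□(x)/(Σ_{□′} θ_{□′}(x)²)^{1/2}`. [cite: Balaban1984PropagatorsII, (2.36) p.229; Balaban1984PropagatorsI, (1.118) p.36] -/
noncomputable def hF (i : ↥(cubes D)) (x : ↥(boxDom (N0 ℓ Mh k P))) : ℝ := thetaF D i (toR x.1) / Real.sqrt (nsqF D x)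

/-- `1 ≤ (Σθ²)^{1/2}`. [cite: Balaban1984PropagatorsII, (2.36) p.229, bookkeeping] -/
theorem one_le_sqrt_nsqF (hMh : 1 ≤ Mh) (x : ↥(boxDom (N0 ℓ Mh k P))) : 1 ≤ Real.sqrt (nsqF D x) := by
  rw [← Real.sqrt_one]; exact Real.sqrt_le_sqrt (one_le_nsqF D hMh x)

/-- `h_□ ≥ 0`. [cite: Balaban1984PropagatorsII, (2.36) p.229, bookkeeping] -/
theorem hF_nonneg (i : ↥(cubes D)) (x : ↥(boxDom (N0 ℓ Mh k P))) : 0 ≤ hF D i x :=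
  div_nonneg (thetaF_nonneg D i _) (Real.sqrt_nonneg _)

/-- `h_□ ≤ θ_□` (the normalising root is `≥ 1`). [cite: Balaban1984PropagatorsII, (2.36) p.229, bookkeeping] -/
theorem hF_le_thetaF (hMh : 1 ≤ Mh) (i : ↥(cubes D)) (x : ↥(boxDom (N0 ℓ Mh k P))) : hF D i x ≤ thetaF D i (toR x.1) :=
  div_le_self (thetaF_nonneg D i _) (one_le_sqrt_nsqF D hMh x)

/-- `h_□ ≤ 1` (from (2.36)). [cite: Balaban1984PropagatorsII, (2.36) p.229, bookkeeping] -/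
theorem hF_le_one (hMh : 1 ≤ Mh) (i : ↥(cubes D)) (x : ↥(boxDom (N0 ℓ Mh k P))) : hF D i x ≤ 1 :=
  (hF_le_thetaF D hMh i x).trans (thetaF_le_one D i _)

/-- `|h_□| ≤ 1` (the binder `hh1` of the (2.134) consumer). [cite: Balaban1984PropagatorsII, (2.36) p.229, (2.134) p.247] -/
theorem abs_hF_le_one (hMh : 1 ≤ Mh) (i : ↥(cubes D)) (x : ↥(boxDom (N0 ℓ Mh k P))) : |hF D i x| ≤ 1 := by
  rw [abs_of_nonneg (hF_nonneg D i x)]; exact hF_le_one D hMh i x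

/-- **(2.36) `Σ_□ h_□(x)² = 1` AT EVERY FINE SITE.** [cite: Balaban1984PropagatorsII, (2.36) p.229] -/
theorem sum_hF_sq (hMh : 1 ≤ Mh) (x : ↥(boxDom (N0 ℓ Mh k P))) : ∑ i, hF D i x ^ 2 = 1 := by
  have h1 := one_le_nsqF D hMh x
  unfold hF
  simp_rw [div_pow]
  rw [← Finset.sum_div, Real.sq_sqrt (by linarith)]
  show nsqF D x / nsqF D x = 1
  exact div_self (ne_of_gt (lt_of_lt_of_le one_pos h1))

/-- the same with `h·h`. [cite: Balaban1984PropagatorsII, (2.36) p.229] -/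
theorem sum_hF_mul_self (hMh : 1 ≤ Mh) (x : ↥(boxDom (N0 ℓ Mh k P))) : ∑ i, hF D i x * hF D i x = 1 := by
  simpa only [sq] using sum_hF_sq D hMh x

/-- `h_□(x) ≠ 0 ⟹ θ_□(x) ≠ 0`. [cite: Balaban1984PropagatorsII, p.229 before (2.36), bookkeeping] -/
theorem thetaF_ne_zero_of_hF_ne_zero {i : ↥(cubes D)} {x : ↥(boxDom (N0 ℓ Mh k P))} (h : hF D i x ≠ 0) :
    thetaF D i (toR x.1) ≠ 0 := fun h0 => h (by unfold hF; rw [h0, zero_div])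

/-- **`supp h_□ ⊂ □`**: `h_□(x) ≠ 0 ⟹ |x − ctr_□|_∞ < S`. [cite: Balaban1984PropagatorsII, p.229 («cubes □ of the size 2ML^jη»)] -/
theorem dist_lt_of_hF_ne_zero (hMh : 1 ≤ Mh) {i : ↥(cubes D)} {x : ↥(boxDom (N0 ℓ Mh k P))} (h : hF D i x ≠ 0) :
    dist (toR x.1) (ctr D i) < side D i :=
  dist_lt_of_thetaF_ne_zero D hMh (thetaF_ne_zero_of_hF_ne_zero D h)

/-! ## §4  The support meets only the two-level window of the cube -/

/-- **THE LEVELS MET BY A CUBE AND ITS COLLAR**: a fine site within `3S/2` of the centre of the cube of an active big `j`-block has level `j − 1`,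
`j` or `j + 1` ((2.2) at the cube's witness, p21's `Domains.lev_window`; the collar `S … 3S/2` serves the neighbours of the sites of □).
[cite: Balaban1984PropagatorsII, (2.2) p.224, p.235 («either □̃ ⊂ B^j(Λ_j), or it intersects B^{j+1}(Λ_{j+1}) also»)] -/
theorem lev_window_of_dist_lt_three_halves (hMh : 1 ≤ Mh) (hR : 2 * (ℓ + 1) ≤ R) {i : ↥(cubes D)}
    {x : ↥(boxDom (N0 ℓ Mh k P))} (h : dist (toR x.1) (ctr D i) < 3 / 2 * side D i) :
    i.1.1 ≤ D.lev x.1 + 1 ∧ D.lev x.1 ≤ i.1.1 + 1 := by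
  have hw : dist (toR (wit D i).1) (ctr D i) ≤ side D i / 2 := dist_toR_ctr_le D hMh (blk_wit D i)
  have hxt : supNorm (x.1 - (wit D i).1) < 2 * (bigSide ℓ Mh i.1.1 : ℝ) := by
    rw [supNorm_eq_dist]
    have hS : side D i = (bigSide ℓ Mh i.1.1 : ℝ) := rfl
    calc dist (toR x.1) (toR (wit D i).1) ≤ dist (toR x.1) (ctr D i) + dist (toR (wit D i).1) (ctr D i) := dist_triangle_right _ _ _
      _ < 3 / 2 * side D i + side D i / 2 := by linarith
      _ = 2 * (bigSide ℓ Mh i.1.1 : ℝ) := by rw [← hS]; ring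
  exact D.lev_window hR (wit D i).2 x.2 (lev_wit D i) hxt

/-- the same for a site within `S` of the centre (the cube □ itself). [cite: Balaban1984PropagatorsII, (2.2) p.224, p.235] -/
theorem lev_window_of_dist_lt (hMh : 1 ≤ Mh) (hR : 2 * (ℓ + 1) ≤ R) {i : ↥(cubes D)} {x : ↥(boxDom (N0 ℓ Mh k P))}
    (h : dist (toR x.1) (ctr D i) < side D i) : i.1.1 ≤ D.lev x.1 + 1 ∧ D.lev x.1 ≤ i.1.1 + 1 :=
  lev_window_of_dist_lt_three_halves D hMh hR (by have := side_pos D hMh i; linarith)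

/-- the levels met by `supp h_□`. [cite: Balaban1984PropagatorsII, (2.2) p.224, p.235] -/
theorem lev_window_of_hF_ne_zero (hMh : 1 ≤ Mh) (hR : 2 * (ℓ + 1) ≤ R) {i : ↥(cubes D)} {x : ↥(boxDom (N0 ℓ Mh k P))}
    (h : hF D i x ≠ 0) : i.1.1 ≤ D.lev x.1 + 1 ∧ D.lev x.1 ≤ i.1.1 + 1 :=
  lev_window_of_dist_lt D hMh hR (dist_lt_of_hF_ne_zero D hMh h)

/-- **THE BLOCKS MET BY A CUBE LIE IN p21's ENLARGED CUBE `□⁺`** (`M_h ≥ 2`): the block of a fine site within `S` of the centre has level `≤ j + 1`,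
hence side `≤ L^{j+1} ≤ S/2`, so its centre is within `5S/4` (where p21's `window`, `hcube`, `gap_of_cubeInd_eq_zero` apply by name).
[cite: Balaban1984PropagatorsII, p.235 («a second cube □̃ containing □ in the middle»), bookkeeping] -/
theorem blkOf_mem_Q (hMh : 2 ≤ Mh) (hR : 2 * (ℓ + 1) ≤ R) {i : ↥(cubes D)} {x : ↥(boxDom (N0 ℓ Mh k P))}
    (h : dist (toR x.1) (ctr D i) < side D i) : blkOf D x ∈ Q D i := by
  have hMh1 : 1 ≤ Mh := le_trans (by norm_num) hMh
  have hlev := (lev_window_of_dist_lt D hMh1 hR h).2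
  have hcen := dist_toR_cen_le D (rfl : blkOf D x = blkOf D x)
  have hL1 : 1 ≤ ℓ + 1 := by omega
  -- the side of the block is at most `L^{j+1} ≤ S/2`
  have hpow : (((ℓ + 1) ^ (blkOf D x).1.1 : ℕ) : ℝ) ≤ (((ℓ + 1) ^ (i.1.1 + 1) : ℕ) : ℝ) := by
    exact_mod_cast Nat.pow_le_pow_right hL1 hlev
  have hside : side D i = (((ℓ + 1) ^ (i.1.1 + 1) : ℕ) : ℝ) * Mh := side_eq D i
  have hMh2 : (2 : ℝ) ≤ Mh := by exact_mod_cast hMh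
  have hp0 : (0 : ℝ) ≤ (((ℓ + 1) ^ (i.1.1 + 1) : ℕ) : ℝ) := by positivity
  have hblk : (((ℓ + 1) ^ (blkOf D x).1.1 : ℕ) : ℝ) ≤ side D i / 2 := by
    rw [hside]; nlinarith
  refine (mem_Q D).2 ?_
  calc dist (cen D (blkOf D x)) (ctr D i) ≤ dist (toR x.1) (cen D (blkOf D x)) + dist (toR x.1) (ctr D i) := dist_triangle_left _ _ _
    _ ≤ 5 / 4 * side D i := by linarith

/-- **`supp h_□` MEETS ONLY BLOCKS OF `□⁺`** (`M_h ≥ 2`): the binder `hhS` of the (2.134) consumer with `S_□ := Q D □`.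
[cite: Balaban1984PropagatorsII, p.235, (2.134) p.247] -/
theorem blkOf_mem_Q_of_hF_ne_zero (hMh : 2 ≤ Mh) (hR : 2 * (ℓ + 1) ≤ R) {i : ↥(cubes D)} {x : ↥(boxDom (N0 ℓ Mh k P))}
    (h : hF D i x ≠ 0) : blkOf D x ∈ Q D i :=
  blkOf_mem_Q D hMh hR (dist_lt_of_hF_ne_zero D (le_trans (by norm_num) hMh) h)

end Literature.MathematicalPhysics.QuantumFieldTheory.Balaban1983to89.B6Partition118KLevelFine
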